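import Summits.MatrixMultiplication.MatrixMultiplication.Theorems.PairwiseCurvedTilingsLC.Negative.GenericInterior
import Summits.MatrixMultiplication.MatrixMultiplication.Theorems.PairwiseCurvedTilingsLC.Negative.RelFactor
import Summits.MatrixMultiplication.MatrixMultiplication.Theorems.PairwiseCurvedTilingsLC.Negative.LiftedChartIdeal
import Summits.MatrixMultiplication.MatrixMultiplication.Theorems.PairwiseCurvedTilingsLC.Negative.ChartLiftBasics
import Summits.MatrixMultiplication.MatrixMultiplication.Theorems.PairwiseCurvedTilingsLC.Negative.ChartLiftRelation
import Literature.ModelTheory.PseudofiniteFields.DefinableSetsToolkit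
import Literature.ModelTheory.PseudofiniteFields.EtaleImagePullback
import Literature.ModelTheory.PseudofiniteFields.Prop27NormalForm

/-!
# The chart induction, Case 2: lifting a good chart through a finite-fibre projection
(line LonelyTranslates c1, Prop27Reduction; part of the proof of `stub_openPiece`)

Setting: `A ⊆ K^{m+1}` definable over a characteristic-`0` pseudo-finite field, all fibres of
`A → K^m` finite, and a GOOD CHART `(σ', D', X')` of the projection `B = {x' | ∃ t, (x', t) ∈ A}`.
We build a good chart of `A` with the same free coordinates and one more bound coordinate (the
last coordinate of `K^{m+1}`, bound as a simple root of an irreducible factor — over the chart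
field — of the generic algebraic relation `P(u; t) = 0` of `exists_poly_vanishing_on_last`):

* `relFactor` factors `P` generically along the chart: `Q_1, …, Q_s`, irreducible over the chart
  field, every root of `P(u(x); ·)` a simple root of some `Q_i(x; ·)` at generic chart points;
* for each `i` the lifted system `(Q_i, D')` has a maximal chart ideal
  (`stub_liftedChartIdeal_isMaximal`), so `stub_relGen` applied to the normal form of `A`
  (`exists_polynomial_normalForm`) makes `A` relatively étale-open in the lifted chart off a
  hypersurface `ρ_i(u) = 0`;
* PIGEONHOLE (`liftChart_dense`): for some `i` the candidate set
  `X_i = {x ∈ A | init x ∈ X', Q_i(x) = 0 ≠ ∂_t Q_i(x), ρ_i(u) ≠ 0}` is Zariski-dense along the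
  free coordinates (else a product of the killing polynomials would kill `X'`);
* that `X_i` is the new chart set: on the chart, relatively open (`liftChart_relOpen`: pull back
  the neighbourhood of `init x` in `X'`, intersect with the simple-root neighbourhoods of the
  `H_l` of `stub_relGen` and a principal open), dense, definable.
-/

set_option linter.dupNamespace false

namespace Summit.MatrixMultiplication.MatrixMultiplication.Theorems.PairwiseCurvedTilingsLC.Negative

open FirstOrder FirstOrder.Language FirstOrder.Ring
open Literature.ModelTheory.PseudofiniteFields
open Polynomial

section Lift

variable {K : Type} [Field K] {m e k : ℕ}

/-- Definability of the candidate chart sets of the lifted chart. [folklore] -/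
theorem liftChart_definable [CompatibleRing K] {A : Set (Fin (m + 1) → K)} {X' : Set (Fin m → K)}
    (hAdef : ∃ (n : ℕ) (φ : Language.ring.Formula (Fin (m + 1) ⊕ Fin n)) (y : Fin n → K),
      A = {x | φ.Realize (Sum.elim x y)})
    (hX'def : ∃ (n : ℕ) (φ : Language.ring.Formula (Fin m ⊕ Fin n)) (y : Fin n → K),
      X' = {x | φ.Realize (Sum.elim x y)})
    (P₁ P₂ P₃ : MvPolynomial (Fin (m + 1)) K) :
    ∃ (n : ℕ) (φ : Language.ring.Formula (Fin (m + 1) ⊕ Fin n)) (y : Fin n → K),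
      {x : Fin (m + 1) → K | Fin.init x ∈ X' ∧ x ∈ A ∧ MvPolynomial.eval x P₁ = 0 ∧
        MvPolynomial.eval x P₂ ≠ 0 ∧ MvPolynomial.eval x P₃ ≠ 0} =
        {x | φ.Realize (Sum.elim x y)} := by
  have h1 : ∃ (n : ℕ) (φ : Language.ring.Formula (Fin (m + 1) ⊕ Fin n)) (y : Fin n → K),
      {x : Fin (m + 1) → K | Fin.init x ∈ X'} = {x | φ.Realize (Sum.elim x y)} := by
    obtain ⟨n', ψ, z, h⟩ := definableSet_preimage_subst (K := K) (m := m) (m' := m + 1) (p := 0)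
      (fun i => Sum.inl (Fin.castSucc i)) Fin.elim0 hX'def
    exact ⟨n', ψ, z, h⟩
  obtain ⟨n, φ, y, h⟩ := definableSet_inter (definableSet_inter (definableSet_inter
    (definableSet_inter h1 hAdef) (definableSet_eval_eq_zero (K := K) P₁))
    (definableSet_eval_ne_zero (K := K) P₂)) (definableSet_eval_ne_zero (K := K) P₃)
  refine ⟨n, φ, y, ?_⟩
  rw [← h]
  ext x
  simp only [Set.mem_inter_iff, Set.mem_setOf_eq, and_assoc]

/-- **Pigeonhole for the lifted chart**: some candidate set is Zariski-dense along the free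
coordinates.  Abstract form: `X'` dense (`hdense`), every point of `X'` lifts (`hlift`) to a
point lying in one of finitely many candidate sets (`hcover`, off a hypersurface `ρ₀ = 0`); then
some candidate set is dense. [folklore] -/
theorem liftChart_dense {s : ℕ} {X' : Set (Fin m → K)} (uσ : Fin e → Fin m)
    (hdense : ∀ c : MvPolynomial (Fin e) K, c ≠ 0 →
      ∃ x' ∈ X', MvPolynomial.eval (fun i => x' (uσ i)) c ≠ 0)
    (Xc : Fin s → Set (Fin (m + 1) → K)) (ρ₀ : MvPolynomial (Fin e) K) (hρ₀ : ρ₀ ≠ 0)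
    (hcover : ∀ x' ∈ X', MvPolynomial.eval (fun i => x' (uσ i)) ρ₀ ≠ 0 →
      ∃ (i : Fin s) (x : Fin (m + 1) → K), x ∈ Xc i ∧ Fin.init x = x') :
    ∃ i : Fin s, ∀ c : MvPolynomial (Fin e) K, c ≠ 0 →
      ∃ x ∈ Xc i, MvPolynomial.eval (fun u => x (Fin.castSucc (uσ u))) c ≠ 0 := by
  classical
  by_contra hcon
  push Not at hcon
  choose c hc0 hc using hcon
  obtain ⟨x', hx', hne⟩ := hdense (ρ₀ * ∏ i, c i)
    (mul_ne_zero hρ₀ (Finset.prod_ne_zero_iff.2 fun i _ => hc0 i))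
  rw [map_mul, map_prod] at hne
  obtain ⟨hρx, hcx⟩ := mul_ne_zero_iff.1 hne
  obtain ⟨i, x, hxX, hinit⟩ := hcover x' hx' hρx
  have := hc i x hxX
  have hux : (fun u => x (Fin.castSucc (uσ u))) = fun u => x' (uσ u) := by
    funext u; rw [← hinit]; rfl
  rw [hux] at this
  exact (Finset.prod_ne_zero_iff.1 hcx i (Finset.mem_univ i)) this

/-- Transport of the normal-form polynomials to split coordinates and back. [folklore] -/
theorem map_map_rename_eval_comp_symm (σ : Fin (m + 1) ≃ Fin e ⊕ Fin (k + 1))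
    (G : Polynomial (MvPolynomial (Fin (m + 1)) K)) (x : Fin (m + 1) → K) :
    ((G.map (MvPolynomial.rename σ).toRingHom).map (MvPolynomial.eval (x ∘ σ.symm))) =
      G.map (MvPolynomial.eval x) := by
  rw [Polynomial.map_map]
  congr 1
  refine RingHom.ext fun p => ?_
  simp only [RingHom.coe_comp, Function.comp_apply, AlgHom.toRingHom_eq_coe, RingHom.coe_coe,
    MvPolynomial.eval_rename]
  have : ((x ∘ σ.symm) ∘ σ : Fin (m + 1) → K) = x := funext fun i => by simp
  rw [this]

/-- **Relative openness of the lifted chart set.**  Hypotheses: the coordinate bookkeeping of the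
lifted splitting (`hl`, `hr`, `h0`), relative openness of the old chart set `X'` (`hX'open`), the
normal form `G` of `A` (`hG`), and the conclusion `hH` of the generic-simple-roots theorem for the
lifted chart applied to the transported normal form.  Conclusion: every point `x` of the candidate
set `X` has a basic étale neighbourhood whose points on the lifted chart lie in `X`. [folklore] -/
theorem liftChart_relOpen {σ' : Fin m ≃ Fin e ⊕ Fin k} {σ : Fin (m + 1) ≃ Fin e ⊕ Fin (k + 1)}
    (hl : ∀ u : Fin e, σ.symm (Sum.inl u) = Fin.castSucc (σ'.symm (Sum.inl u)))
    (hr : ∀ j : Fin k, σ.symm (Sum.inr j.succ) = Fin.castSucc (σ'.symm (Sum.inr j)))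
    (D' : Fin k → MvPolynomial (Fin e ⊕ Fin k) K) (Qn : MvPolynomial (Fin e ⊕ Fin (k + 1)) K)
    {X' : Set (Fin m → K)}
    (hX'open : ∀ x' ∈ X', ∃ (r : ℕ) (E : EtaleDatum K m r), x' ∈ E.image ∧ ∀ x'' ∈ E.image,
      (∀ j, MvPolynomial.eval (x'' ∘ σ'.symm) (D' j) = 0) →
      (∀ j, MvPolynomial.eval (x'' ∘ σ'.symm) (MvPolynomial.pderiv (Sum.inr j) (D' j)) ≠ 0) →
        x'' ∈ X')
    (hX'chart : ∀ x' ∈ X', (∀ j, MvPolynomial.eval (x' ∘ σ'.symm) (D' j) = 0) ∧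
      ∀ j, MvPolynomial.eval (x' ∘ σ'.symm) (MvPolynomial.pderiv (Sum.inr j) (D' j)) ≠ 0)
    {A : Set (Fin (m + 1) → K)} {L : ℕ} (G : Fin L → Polynomial (MvPolynomial (Fin (m + 1)) K))
    (hG : ∀ x, x ∈ A ↔ ∀ l, ∃ s : K, ((G l).map (MvPolynomial.eval x)).eval s = 0)
    (ρ : MvPolynomial (Fin e) K) (H : Fin L → Polynomial (MvPolynomial (Fin e ⊕ Fin (k + 1)) K))
    (hH : ∀ z : Fin e ⊕ Fin (k + 1) → K,
      (∀ j, MvPolynomial.eval z ((Fin.cons Qn (fun j => MvPolynomial.rename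
        (Sum.map id Fin.succ : Fin e ⊕ Fin k → Fin e ⊕ Fin (k + 1)) (D' j)) :
          Fin (k + 1) → MvPolynomial (Fin e ⊕ Fin (k + 1)) K) j) = 0) →
      MvPolynomial.eval (z ∘ Sum.inl) ρ ≠ 0 → ∀ l,
        (∀ s, ((H l).map (MvPolynomial.eval z)).eval s = 0 →
          (((G l).map (MvPolynomial.rename σ).toRingHom).map (MvPolynomial.eval z)).eval s = 0) ∧
        ((∃ s, (((G l).map (MvPolynomial.rename σ).toRingHom).map (MvPolynomial.eval z)).eval s = 0) →
          ∃ s, ((H l).map (MvPolynomial.eval z)).eval s = 0) ∧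
        (∀ s, ((H l).map (MvPolynomial.eval z)).eval s = 0 →
          (derivative ((H l).map (MvPolynomial.eval z))).eval s ≠ 0)) :
    ∀ x ∈ {x : Fin (m + 1) → K | Fin.init x ∈ X' ∧ x ∈ A ∧
        MvPolynomial.eval (x ∘ σ.symm) Qn = 0 ∧
        MvPolynomial.eval (x ∘ σ.symm) (MvPolynomial.pderiv (Sum.inr 0) Qn) ≠ 0 ∧
        MvPolynomial.eval (fun u => x (σ.symm (Sum.inl u))) ρ ≠ 0},
      ∃ (r : ℕ) (E : EtaleDatum K (m + 1) r), x ∈ E.image ∧ ∀ x'' ∈ E.image,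
        (∀ j, MvPolynomial.eval (x'' ∘ σ.symm) ((Fin.cons Qn (fun j => MvPolynomial.rename
          (Sum.map id Fin.succ : Fin e ⊕ Fin k → Fin e ⊕ Fin (k + 1)) (D' j)) :
            Fin (k + 1) → MvPolynomial (Fin e ⊕ Fin (k + 1)) K) j) = 0) →
        (∀ j, MvPolynomial.eval (x'' ∘ σ.symm) (MvPolynomial.pderiv (Sum.inr j)
          ((Fin.cons Qn (fun j => MvPolynomial.rename
            (Sum.map id Fin.succ : Fin e ⊕ Fin k → Fin e ⊕ Fin (k + 1)) (D' j)) :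
              Fin (k + 1) → MvPolynomial (Fin e ⊕ Fin (k + 1)) K) j)) ≠ 0) →
        x'' ∈ {x : Fin (m + 1) → K | Fin.init x ∈ X' ∧ x ∈ A ∧
          MvPolynomial.eval (x ∘ σ.symm) Qn = 0 ∧
          MvPolynomial.eval (x ∘ σ.symm) (MvPolynomial.pderiv (Sum.inr 0) Qn) ≠ 0 ∧
          MvPolynomial.eval (fun u => x (σ.symm (Sum.inl u))) ρ ≠ 0} := by
  classical
  intro x hx
  obtain ⟨hxX', hxA, hxQ, hxdQ, hxρ⟩ := hx
  -- old chart conditions from lifted ones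
  have hold : ∀ x'' : Fin (m + 1) → K,
      (∀ j, MvPolynomial.eval (x'' ∘ σ.symm) ((Fin.cons Qn (fun j => MvPolynomial.rename
        (Sum.map id Fin.succ : Fin e ⊕ Fin k → Fin e ⊕ Fin (k + 1)) (D' j)) :
          Fin (k + 1) → MvPolynomial (Fin e ⊕ Fin (k + 1)) K) j) = 0) →
      (∀ j, MvPolynomial.eval (x'' ∘ σ.symm) (MvPolynomial.pderiv (Sum.inr j)
        ((Fin.cons Qn (fun j => MvPolynomial.rename
          (Sum.map id Fin.succ : Fin e ⊕ Fin k → Fin e ⊕ Fin (k + 1)) (D' j)) :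
            Fin (k + 1) → MvPolynomial (Fin e ⊕ Fin (k + 1)) K) j)) ≠ 0) →
      (∀ j, MvPolynomial.eval (Fin.init x'' ∘ σ'.symm) (D' j) = 0) ∧
      (∀ j, MvPolynomial.eval (Fin.init x'' ∘ σ'.symm)
        (MvPolynomial.pderiv (Sum.inr j) (D' j)) ≠ 0) := by
    intro x'' hD hpd
    refine ⟨fun j => ?_, fun j => ?_⟩
    · have := hD j.succ
      rwa [Fin.cons_succ, eval_rename_sumMap_succ, comp_liftSplit_sumMap hl hr] at this
    · have := hpd j.succ
      rwa [Fin.cons_succ, pderiv_inr_succ_rename_sumMap_succ, eval_rename_sumMap_succ,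
        comp_liftSplit_sumMap hl hr] at this
  -- (a) the neighbourhood of `init x` in `X'`, pulled back
  obtain ⟨r', E', hxE', hE'⟩ := hX'open (Fin.init x) hxX'
  obtain ⟨Ea, hEa⟩ := E'.exists_image_eq_preimage_comp (Fin.castSucc : Fin m → Fin (m + 1))
  -- (b) the simple-root neighbourhoods of the `H_l`
  choose E₁ hE₁ using fun l => exists_etaleDatum_simpleRoot (K := K)
    ((H l).map (MvPolynomial.rename (σ.symm : Fin e ⊕ Fin (k + 1) → Fin (m + 1))).toRingHom)
  have hHx : ∀ (l) (x'' : Fin (m + 1) → K),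
      ((H l).map (MvPolynomial.rename (σ.symm : Fin e ⊕ Fin (k + 1) → Fin (m + 1))).toRingHom).map
        (MvPolynomial.eval x'') = (H l).map (MvPolynomial.eval (x'' ∘ σ.symm)) := by
    intro l x''
    rw [Polynomial.map_map]
    congr 1
    refine RingHom.ext fun p => ?_
    simp [MvPolynomial.eval_rename]
  -- (c) the principal open `ρ(u) ≠ 0`, together with (b)
  obtain ⟨r₁, Eb, hEb⟩ := exists_etaleDatum_iInter_inter (fun _ => 1) E₁
    (MvPolynomial.rename (fun u => σ.symm (Sum.inl u)) ρ)
  obtain ⟨E, hE⟩ := Ea.exists_image_eq_inter Eb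
  have hρx'' : ∀ x'' : Fin (m + 1) → K,
      MvPolynomial.eval x'' (MvPolynomial.rename (fun u => σ.symm (Sum.inl u)) ρ) =
        MvPolynomial.eval (fun u => x'' (σ.symm (Sum.inl u))) ρ := by
    intro x''; rw [MvPolynomial.eval_rename]; rfl
  have hzinl : ∀ x'' : Fin (m + 1) → K, (x'' ∘ σ.symm) ∘ Sum.inl = fun u => x'' (σ.symm (Sum.inl u)) :=
    fun _ => rfl
  -- chart conditions at `x` itself
  have hxD : ∀ j, MvPolynomial.eval (x ∘ σ.symm) ((Fin.cons Qn (fun j => MvPolynomial.rename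
      (Sum.map id Fin.succ : Fin e ⊕ Fin k → Fin e ⊕ Fin (k + 1)) (D' j)) :
        Fin (k + 1) → MvPolynomial (Fin e ⊕ Fin (k + 1)) K) j) = 0 := by
    intro j
    cases j using Fin.cases with
    | zero => simpa using hxQ
    | succ j =>
      rw [Fin.cons_succ, eval_rename_sumMap_succ, comp_liftSplit_sumMap hl hr]
      exact (hX'chart _ hxX').1 j
  have hGx : ∀ x'' : Fin (m + 1) → K, ∀ l,
      (((G l).map (MvPolynomial.rename σ).toRingHom).map (MvPolynomial.eval (x'' ∘ σ.symm))) =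
        (G l).map (MvPolynomial.eval x'') := fun x'' l => map_map_rename_eval_comp_symm σ (G l) x''
  refine ⟨_, E, ?_, fun x'' hx'' hD hpd => ?_⟩
  · -- `x ∈ E.image`
    rw [hE, hEa, hEb]
    refine ⟨?_, ?_, Set.mem_iInter.2 fun l => ?_⟩
    · exact hxE'
    · simp only [Set.mem_setOf_eq, hρx'']; exact hxρ
    · rw [hE₁, Set.mem_setOf_eq, hHx]
      obtain ⟨-, hR2, hR3⟩ := hH (x ∘ σ.symm) hxD (by rw [hzinl]; exact hxρ) l
      obtain ⟨s, hs⟩ := (hG x).1 hxA l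
      obtain ⟨s', hs'⟩ := hR2 ⟨s, by rw [hGx]; exact hs⟩
      exact ⟨s', hs', hR3 s' hs'⟩
  · -- points of `E` on the lifted chart lie in `X`
    rw [hE, hEa, hEb] at hx''
    obtain ⟨hx''a, hx''ρ, hx''b⟩ := hx''
    simp only [Set.mem_setOf_eq, hρx''] at hx''ρ
    obtain ⟨hold1, hold2⟩ := hold x'' hD hpd
    refine ⟨hE' _ hx''a hold1 hold2, ?_, ?_, ?_, hx''ρ⟩
    · refine (hG x'').2 fun l => ?_
      have hl' := Set.mem_iInter.1 hx''b l
      rw [hE₁, Set.mem_setOf_eq, hHx] at hl'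
      obtain ⟨s, hs, -⟩ := hl'
      obtain ⟨hR1, -, -⟩ := hH (x'' ∘ σ.symm) hD (by rw [hzinl]; exact hx''ρ) l
      exact ⟨s, by rw [← hGx]; exact hR1 s hs⟩
    · simpa using hD 0
    · simpa using hpd 0

/-- **Case 2 of the chart induction (lifting a good chart).** -/
theorem chartLift (h27 : ChatzidakisVanDenDriesMacintyre1992_prop27)
    (K : Type) [Field K] [CompatibleRing K] [CharZero K] (hK : K ⊨ finiteFieldTheory)
    {m n e k : ℕ} (φ : Language.ring.Formula (Fin (m + 1) ⊕ Fin n)) (y : Fin n → K)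
    (hfin : ∀ x' : Fin m → K, {t : K | φ.Realize (Sum.elim (Fin.snoc x' t : Fin (m + 1) → K) y)}.Finite)
    (he : 1 ≤ e) (σ' : Fin m ≃ Fin e ⊕ Fin k) (D' : Fin k → MvPolynomial (Fin e ⊕ Fin k) K)
    (htri' : ∀ j i : Fin k, i < j → MvPolynomial.pderiv (Sum.inr i) (D' j) = 0)
    (hmax' : (Ideal.span (Set.range fun j => MvPolynomial.aeval
      (Sum.elim (fun i => MvPolynomial.C (algebraMap (MvPolynomial (Fin e) K)
        (FractionRing (MvPolynomial (Fin e) K)) (MvPolynomial.X i)))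
        (fun j => MvPolynomial.X j)) (D' j) :
          Set (MvPolynomial (Fin k) (FractionRing (MvPolynomial (Fin e) K))))).IsMaximal)
    (X' : Set (Fin m → K))
    (hX'B : ∀ x' ∈ X', ∃ t : K, φ.Realize (Sum.elim (Fin.snoc x' t : Fin (m + 1) → K) y))
    (hX'chart : ∀ x' ∈ X', (∀ j, MvPolynomial.eval (x' ∘ σ'.symm) (D' j) = 0) ∧
      ∀ j, MvPolynomial.eval (x' ∘ σ'.symm) (MvPolynomial.pderiv (Sum.inr j) (D' j)) ≠ 0)
    (hX'open : ∀ x' ∈ X', ∃ (r : ℕ) (E : EtaleDatum K m r), x' ∈ E.image ∧ ∀ x'' ∈ E.image,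
      (∀ j, MvPolynomial.eval (x'' ∘ σ'.symm) (D' j) = 0) →
      (∀ j, MvPolynomial.eval (x'' ∘ σ'.symm) (MvPolynomial.pderiv (Sum.inr j) (D' j)) ≠ 0) →
        x'' ∈ X')
    (hX'dense : ∀ c : MvPolynomial (Fin e) K, c ≠ 0 →
      ∃ x' ∈ X', MvPolynomial.eval (fun i => x' (σ'.symm (Sum.inl i))) c ≠ 0)
    (hX'def : ∃ (n' : ℕ) (ψ : Language.ring.Formula (Fin m ⊕ Fin n')) (z : Fin n' → K),
      X' = {x | ψ.Realize (Sum.elim x z)}) :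
    ∃ (e₁ k₁ : ℕ) (σ : Fin (m + 1) ≃ Fin e₁ ⊕ Fin k₁)
      (D : Fin k₁ → MvPolynomial (Fin e₁ ⊕ Fin k₁) K) (X : Set (Fin (m + 1) → K)),
      1 ≤ e₁ ∧
      (∀ j i : Fin k₁, i < j → MvPolynomial.pderiv (Sum.inr i) (D j) = 0) ∧
      (Ideal.span (Set.range fun j => MvPolynomial.aeval
        (Sum.elim (fun i => MvPolynomial.C (algebraMap (MvPolynomial (Fin e₁) K)
          (FractionRing (MvPolynomial (Fin e₁) K)) (MvPolynomial.X i)))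
          (fun j => MvPolynomial.X j)) (D j) :
            Set (MvPolynomial (Fin k₁) (FractionRing (MvPolynomial (Fin e₁) K))))).IsMaximal ∧
      X ⊆ {x | φ.Realize (Sum.elim x y)} ∧
      (∀ x ∈ X, (∀ j, MvPolynomial.eval (x ∘ σ.symm) (D j) = 0) ∧
        ∀ j, MvPolynomial.eval (x ∘ σ.symm) (MvPolynomial.pderiv (Sum.inr j) (D j)) ≠ 0) ∧
      (∀ x ∈ X, ∃ (r : ℕ) (E : EtaleDatum K (m + 1) r), x ∈ E.image ∧ ∀ x' ∈ E.image,
        (∀ j, MvPolynomial.eval (x' ∘ σ.symm) (D j) = 0) →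
        (∀ j, MvPolynomial.eval (x' ∘ σ.symm) (MvPolynomial.pderiv (Sum.inr j) (D j)) ≠ 0) →
          x' ∈ X) ∧
      (∀ c : MvPolynomial (Fin e₁) K, c ≠ 0 →
        ∃ x ∈ X, MvPolynomial.eval (fun i => x (σ.symm (Sum.inl i))) c ≠ 0) ∧
      (∃ (n' : ℕ) (ψ : Language.ring.Formula (Fin (m + 1) ⊕ Fin n')) (z : Fin n' → K),
        X = {x | ψ.Realize (Sum.elim x z)}) := by
  classical
  haveI : Infinite K := Infinite.of_injective (Nat.cast : ℕ → K) Nat.cast_injective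
  -- step A: the algebraic relation for the last coordinate
  obtain ⟨P, hP0, hPvan⟩ :=
    exists_poly_vanishing_on_last h27 K hK φ y σ' D' htri' X' hX'def hX'chart hfin
  -- generic factorisation along the chart
  obtain ⟨ρf, hρf0, s, Q, hirr, hroots⟩ := relFactor D' hmax' P hP0
  -- the lifted splitting and the normal form of `A`
  obtain ⟨σ, -, -, hσ0, hσl, hσr⟩ := exists_liftSplit (m := m) σ'
  obtain ⟨L, G, hG⟩ := h27.exists_polynomial_normalForm φ K hK y
  -- generic simple roots on each lifted chart
  have hrel : ∀ i : Fin s, ∃ ρA : MvPolynomial (Fin e) K, ρA ≠ 0 ∧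
      ∃ H : Fin L → Polynomial (MvPolynomial (Fin e ⊕ Fin (k + 1)) K),
        ∀ z : Fin e ⊕ Fin (k + 1) → K,
          (∀ j, MvPolynomial.eval z ((Fin.cons ((Q i).eval₂ (MvPolynomial.rename
            (Sum.map id Fin.succ : Fin e ⊕ Fin k → Fin e ⊕ Fin (k + 1))).toRingHom
              (MvPolynomial.X (Sum.inr 0)))
            (fun j => MvPolynomial.rename (Sum.map id Fin.succ : Fin e ⊕ Fin k → Fin e ⊕ Fin (k + 1))
              (D' j)) : Fin (k + 1) → MvPolynomial (Fin e ⊕ Fin (k + 1)) K) j) = 0) →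
          MvPolynomial.eval (z ∘ Sum.inl) ρA ≠ 0 → ∀ l,
            (∀ t, ((H l).map (MvPolynomial.eval z)).eval t = 0 →
              (((G l).map (MvPolynomial.rename σ).toRingHom).map (MvPolynomial.eval z)).eval t = 0) ∧
            ((∃ t, (((G l).map (MvPolynomial.rename σ).toRingHom).map (MvPolynomial.eval z)).eval t = 0) →
              ∃ t, ((H l).map (MvPolynomial.eval z)).eval t = 0) ∧
            (∀ t, ((H l).map (MvPolynomial.eval z)).eval t = 0 →
              (derivative ((H l).map (MvPolynomial.eval z))).eval t ≠ 0) := fun i =>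
    stub_relGen _ (stub_liftedChartIdeal_isMaximal D' hmax' (Q i) (hirr i)) _
  choose ρA hρA0 H hH using hrel
  -- abbreviations: the placed factor, the free-coordinate map
  set Qn : Fin s → MvPolynomial (Fin e ⊕ Fin (k + 1)) K := fun i => (Q i).eval₂ (MvPolynomial.rename
    (Sum.map id Fin.succ : Fin e ⊕ Fin k → Fin e ⊕ Fin (k + 1))).toRingHom (MvPolynomial.X (Sum.inr 0))
    with hQn
  set A : Set (Fin (m + 1) → K) := {x | φ.Realize (Sum.elim x y)} with hA
  -- candidate chart sets
  set Xc : Fin s → Set (Fin (m + 1) → K) := fun i => {x | Fin.init x ∈ X' ∧ x ∈ A ∧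
      MvPolynomial.eval (x ∘ σ.symm) (Qn i) = 0 ∧
      MvPolynomial.eval (x ∘ σ.symm) (MvPolynomial.pderiv (Sum.inr 0) (Qn i)) ≠ 0 ∧
      MvPolynomial.eval (fun u => x (σ.symm (Sum.inl u))) (ρf * ρA i) ≠ 0} with hXc
  -- the pigeonhole: some candidate set is dense along the free coordinates
  have hcover : ∀ x' ∈ X', MvPolynomial.eval (fun i => x' (σ'.symm (Sum.inl i))) (ρf * ∏ i, ρA i) ≠ 0 →
      ∃ (i : Fin s) (x : Fin (m + 1) → K), x ∈ Xc i ∧ Fin.init x = x' := by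
    intro x' hx' hne
    rw [map_mul, map_prod] at hne
    obtain ⟨hρfx, hρAx⟩ := mul_ne_zero_iff.1 hne
    obtain ⟨t, ht⟩ := hX'B x' hx'
    obtain ⟨hc1, hc2⟩ := hX'chart x' hx'
    obtain ⟨hr1, hr2⟩ := hroots (x' ∘ σ'.symm) hc1 hρfx
    have hP := hPvan (Fin.snoc x' t) ht (by simpa using hx')
    simp only [Fin.snoc_castSucc, Fin.snoc_last] at hP
    obtain ⟨i, hi⟩ := hr1 t hP
    refine ⟨i, Fin.snoc x' t, ⟨by simpa using hx', ht, ?_, ?_, ?_⟩, by simp⟩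
    · rw [hQn]; dsimp only
      rw [eval_eval₂_rename_sumMap_succ, comp_liftSplit_sumMap hσl hσr, Fin.init_snoc,
        Function.comp_apply, hσ0, Fin.snoc_last]
      exact hi
    · rw [hQn]; dsimp only
      rw [pderiv_inr_zero_eval₂_rename_sumMap_succ, eval_eval₂_rename_sumMap_succ,
        comp_liftSplit_sumMap hσl hσr, Fin.init_snoc, Function.comp_apply, hσ0, Fin.snoc_last,
        ← Polynomial.derivative_map]
      exact hr2 i t hi
    · rw [map_mul]
      refine mul_ne_zero ?_ ?_
      · simpa [hσl] using hρfx
      · have := Finset.prod_ne_zero_iff.1 hρAx i (Finset.mem_univ i)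
        simpa [hσl] using this
  obtain ⟨i₀, hdense⟩ := liftChart_dense (fun u => σ'.symm (Sum.inl u)) hX'dense Xc
    (ρf * ∏ i, ρA i) (mul_ne_zero hρf0 (Finset.prod_ne_zero_iff.2 fun i _ => hρA0 i)) hcover
  -- the chart
  refine ⟨e, k + 1, σ, Fin.cons (Qn i₀) (fun j => MvPolynomial.rename
      (Sum.map id Fin.succ : Fin e ⊕ Fin k → Fin e ⊕ Fin (k + 1)) (D' j)), Xc i₀, he,
    liftChart_triangular (Q i₀) D' htri', stub_liftedChartIdeal_isMaximal D' hmax' (Q i₀) (hirr i₀),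
    fun x hx => hx.2.1, fun x hx => ?_, ?_, fun c hc => ?_, ?_⟩
  · -- on the chart
    obtain ⟨hxX', -, hxQ, hxdQ, -⟩ := hx
    refine ⟨fun j => ?_, fun j => ?_⟩
    · cases j using Fin.cases with
      | zero => simpa using hxQ
      | succ j =>
        rw [Fin.cons_succ, eval_rename_sumMap_succ, comp_liftSplit_sumMap hσl hσr]
        exact (hX'chart _ hxX').1 j
    · cases j using Fin.cases with
      | zero => simpa using hxdQ
      | succ j =>
        rw [Fin.cons_succ, pderiv_inr_succ_rename_sumMap_succ, eval_rename_sumMap_succ,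
          comp_liftSplit_sumMap hσl hσr]
        exact (hX'chart _ hxX').2 j
  · -- relative openness
    refine liftChart_relOpen hσl hσr D' (Qn i₀) hX'open hX'chart G (fun x => hG x) (ρf * ρA i₀) (H i₀)
      fun z hz hρz => hH i₀ z hz ?_
    rw [map_mul] at hρz
    exact (mul_ne_zero_iff.1 hρz).2
  · -- density along the free coordinates
    obtain ⟨x, hx, hne⟩ := hdense c hc
    exact ⟨x, hx, by simpa [hσl] using hne⟩
  · -- definability
    obtain ⟨n', ψ, z, h⟩ := liftChart_definable ⟨n, φ, y, rfl⟩ hX'def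
      (MvPolynomial.rename (σ.symm : Fin e ⊕ Fin (k + 1) → Fin (m + 1)) (Qn i₀))
      (MvPolynomial.rename (σ.symm : Fin e ⊕ Fin (k + 1) → Fin (m + 1))
        (MvPolynomial.pderiv (Sum.inr 0) (Qn i₀)))
      (MvPolynomial.rename (fun u => σ.symm (Sum.inl u)) (ρf * ρA i₀))
    refine ⟨n', ψ, z, ?_⟩
    rw [← h]
    ext x
    simp only [Set.mem_setOf_eq, MvPolynomial.eval_rename]
    rfl

end Lift

end Summit.MatrixMultiplication.MatrixMultiplication.Theorems.PairwiseCurvedTilingsLC.Negative
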